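import Summits.AtomisticToContinuum.Crystallization.Theorems.FrustratedLawDichotomyStrainedPatchHomEntryFitHcpKit

/-!
# The reflected hcp (P1) FIT prune, part 2: soundness of `fitOKH`, the full hcp entry-leaf verdict, and `(H) HomFloor m` from two Booleans with (P1) on
# BOTH families

decomp-a2c hand-2 g22 (crux `AperiodicFrustratedLawGap`, stmt-AtomisticToContinuum-27623; sequel of `…HomEntryFitHcpKit`).

* §1 ★★ `fitOKH_sound : fitOKH c w = true ⟹` the prune disjunct (`TightNearCap` at the centre) for every `U` with `‖U − 1‖ ≤ 1/4` and every `ξ` whose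
  coordinates lie in the box — via `goodAtScale_of_fitBounds_hcp`; the misfit chain `‖nbrU k − d·nbr k‖ ≤ ‖Vq_k‖ + ‖Vq_k'‖ + 2λ‖ξ‖` (`V = U − λ·1`,
  `q_k = nbr k + s_k ξ`), squared by Cauchy into `6ρ² + 12λ²‖ξ‖²`; `‖ξ‖ ≤ 1/2` from the kernel bound on `xiSq`;
* §2 the full hcp verdict `entryLeafOKH2 μ := fitOKH ∨ entryLeafOKHc μ` ((P1) ∨ symmetry ∨ column ∨ (P4)), its soundness, `hcpHalf_of_entryFitTree`, and
  ★★★ `homFloor_of_entryFitTrees : 2(m+e_W)SC ≤ μ → treeOK (entryLeafOKF μ) tF rootC rootW = true → treeOK (entryLeafOKH2 μ) tH rootCH rootWH = true →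
  HomFloor m` — the (H) piece from two Booleans, now with the fit prune available on both families;
* §3 kernel smoke test: `fitOKH` FIRES on the entry/shuffle box of half-width `2⁻⁹` at the unstrained hcp crystal and fails under a `0.15` shuffle.

All definitions computable; 0 sorry; standard axioms; no instances / notation.  `--supports stmt-AtomisticToContinuum-27623`.
-/

namespace Summit.AtomisticToContinuum.Crystallization.Theorems.FrustratedLawDichotomyStrainedPatchHomEntryFitHcp

open scoped BigOperators RealInnerProductSpace
open Literature.Analysis.ValidatedNumerics.Numerics
open Literature.Geometry.DiscreteGeometry (hcpKissingPattern)
open Literature.Geometry.DiscreteGeometry.ShellCensus (hcpTuple hcpTuple_injective)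
open Summit.AtomisticToContinuum.Crystallization.Theorems.ChargedEnergyGapNegative (E3)
open Summit.AtomisticToContinuum.Crystallization.Theorems.FrustratedLawDichotomySchurCut (effPot w₄₅ ω₄)
open Summit.AtomisticToContinuum.Crystallization.Theorems.FrustratedLawDichotomyMotifLemmas (GoodAtScale)
open Summit.AtomisticToContinuum.Crystallization.Theorems.FrustratedLawDichotomyAveragingRuleTightFree (TightNearCap BadNearCap)
open Summit.AtomisticToContinuum.Crystallization.Theorems.FrustratedLawDichotomyExemptAbsorption (ExemptNear)
open Summit.AtomisticToContinuum.Crystallization.Theorems.FrustratedLawDichotomyStrainedPatchHomSplit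
open Summit.AtomisticToContinuum.Crystallization.Theorems.FrustratedLawDichotomyStrainedPatchHomGram (norm_sq_latPt_eq_sum_gram norm_sq_latPt_add_eq_sum_gram)
open Summit.AtomisticToContinuum.Crystallization.Theorems.FrustratedLawDichotomyStrainedPatchHomLatticeBox (norm_apply_ge_of_near_one latPt_zero)
open Summit.AtomisticToContinuum.Crystallization.Theorems.FrustratedLawDichotomyStrainedPatchHomLatticeBoxHcp
  (latPt_eq_apply_one shifted_eq_apply mem_box_of_norm_hexPt_lt mem_box_of_norm_hexPt_add_shift_lt)
open Summit.AtomisticToContinuum.Crystallization.Theorems.FrustratedLawDichotomyStrainedPatchHomPrunesFit (goodAtScale_centre_of_fit_hcpPattern)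
open Summit.AtomisticToContinuum.Crystallization.Theorems.FrustratedLawDichotomyAveragingCut (self_mem_ball)
open Summit.AtomisticToContinuum.Crystallization.Theorems.FrustratedLawDichotomyStrainedPatchHomPrunes (locHom_hcp_centre)
open Summit.AtomisticToContinuum.Crystallization.Theorems.FrustratedLawDichotomyStrainedPatchHomPrunedPolar (homFloor_of_prunedBoxSums_selfAdjoint)
open Summit.AtomisticToContinuum.Crystallization.Theorems.FrustratedLawDichotomyStrainedPatchHomLeafCheckC (iccC iccC_eq)
open Summit.AtomisticToContinuum.Crystallization.Theorems.FrustratedLawDichotomyStrainedPatchHomCertTree (CertTree treeOK)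
open Summit.AtomisticToContinuum.Crystallization.Theorems.FrustratedLawDichotomyStrainedPatchHomEntryGram
open Summit.AtomisticToContinuum.Crystallization.Theorems.FrustratedLawDichotomyStrainedPatchHomEntryFitKit (lmin lmin_le_of_mem lmin_mem)
open Summit.AtomisticToContinuum.Crystallization.Theorems.FrustratedLawDichotomyStrainedPatchHomEntryFit (scaleL devFI entryLeafOKF fccHalf_of_entryFitTree lmax le_lmax_of_mem)
open Summit.AtomisticToContinuum.Crystallization.Theorems.FrustratedLawDichotomyStrainedPatchHomEntryGramHcp
open Summit.AtomisticToContinuum.Crystallization.Theorems.FrustratedLawDichotomyStrainedPatchHomEntryHcpFrame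
open Summit.AtomisticToContinuum.Crystallization.Theorems.FrustratedLawDichotomyTwoShellRigidityAssemblyDial (hcpTuple_mem exists_hcpTuple_eq)

open Summit.AtomisticToContinuum.Crystallization.Theorems.FrustratedLawDichotomyStrainedPatchHomEntryFitHcpKit

/-! ## §1. Soundness of the hcp fit verdict -/

/-- ★★ **SOUNDNESS OF THE hcp FIT VERDICT**: `fitOKH c w = true` ⟹ the prune disjunct for every `U` with `‖U − 1‖ ≤ 1/4` and `ξ` with `‖ξ‖ ≤ 1/4` whose
coordinates lie in the box. [folklore] -/
theorem fitOKH_sound {c w : (Fin 3 × Fin 3) ⊕ Fin 3 → ℤ} (h : fitOKH c w = true) (U : E3 →L[ℝ] E3) (ξ : E3) (hU : ‖U - 1‖ ≤ 1 / 4)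
    (hbox : ∀ ab : Fin 3 × Fin 3, |(U (EuclideanSpace.single ab.2 (1 : ℝ))) ab.1 - (c (Sum.inl ab) : ℝ) / SC| ≤ (w (Sum.inl ab) : ℝ) / SC)
    (hξb : ∀ i : Fin 3, |ξ i - (c (Sum.inr i) : ℝ) / SC| ≤ (w (Sum.inr i) : ℝ) / SC) :
    ∀ (M : ℕ) (z : Fin M → E3) (c : Fin M), Function.Injective z →
      Set.range z = {x : E3 | dist x (z c) ≤ 133 / 10 ∧ ∃ a : Fin 3 → ℤ,
        x = z c + latPt U hexFrame a ∨ x = z c + latPt U hexFrame a + U (hcpShift + ξ)} →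
      TightNearCap (9 / 5) (3 / 2) z c ∨ ExemptNear (9 / 5) ExRec z c ∨ BadNearCap (9 / 5) (3 / 2) z c := by
  simp only [fitOKH, Bool.and_eq_true, decide_eq_true_eq, List.all_eq_true] at h
  obtain ⟨⟨⟨⟨⟨⟨⟨⟨hL0, h0⟩, h01⟩, h32⟩, h130⟩, hxi4⟩, hfitZ⟩, hK⟩, hfar⟩ := h
  have hS := SC_pos
  have hne := SC_ne
  set cU : Fin 3 × Fin 3 → ℤ := fun ab => c (Sum.inl ab) with hcU
  set lam : ℝ := (scaleL cU : ℝ) / SC with hlam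
  have hlam0 : 0 ≤ lam := div_nonneg (by exact_mod_cast hL0) hS.le
  set V : E3 →L[ℝ] E3 := U - lam • (1 : E3 →L[ℝ] E3) with hVdef
  have hV : ∀ x : E3, U x = lam • x + V x := fun x => by
    have : V x = U x - lam • x := by simp [hVdef]
    rw [this]; abel
  -- enclosures of the extended Gram data of `U` and of `V`
  have hE : ∀ ab : Fin 3 × Fin 3, FI.mem ((U (EuclideanSpace.single ab.2 (1 : ℝ))) ab.1) (entU c w ab) := fun ab => mem_entryFI (hbox ab)
  have hE' := FrustratedLawDichotomyStrainedPatchHomEntryFit.mem_devFI U (scaleL cU) hbox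
  have hX : ∀ i, FI.mem (ξ i) (shufFI c w i) := fun i => mem_shufFI (hξb i)
  obtain ⟨hUG, hUC, hUT⟩ : (∀ i j, FI.mem ⟪U (hexFrame i), U (hexFrame j)⟫ (extU c w (Sum.inl (i, j)))) ∧
      (∀ i, FI.mem ⟪U (hexFrame i), U (hcpShift + ξ)⟫ (extU c w (Sum.inr (Sum.inl i)))) ∧
      FI.mem (‖U (hcpShift + ξ)‖ ^ 2) (extU c w (Sum.inr (Sum.inr 0))) := mem_extFI U ξ hE hX
  obtain ⟨hVG, hVC, hVT⟩ : (∀ i j, FI.mem ⟪V (hexFrame i), V (hexFrame j)⟫ (extV c w (scaleL cU) (Sum.inl (i, j)))) ∧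
      (∀ i, FI.mem ⟪V (hexFrame i), V (hcpShift + ξ)⟫ (extV c w (scaleL cU) (Sum.inr (Sum.inl i)))) ∧
      FI.mem (‖V (hcpShift + ξ)‖ ^ 2) (extV c w (scaleL cU) (Sum.inr (Sum.inr 0))) := mem_extFI V ξ hE' hX
  -- per label: ‖nbrU k‖² and ‖V q_k‖²
  have hnbr : ∀ k, FI.mem (‖nbrU U ξ k‖ ^ 2) (nbrSq c w k) := fun k => by
    have := mem_qform13 U (hcpShift + ξ) hUG hUC hUT (hlab k) (hshift k)
    unfold nbrU nbrSq; exact this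
  have hdev : ∀ k, FI.mem (‖latPt V hexFrame (hlab k) + if hshift k then V (hcpShift + ξ) else 0‖ ^ 2) (devSqH c w (scaleL cU) k) := fun k =>
    mem_qform13 V (hcpShift + ξ) hVG hVC hVT (hlab k) (hshift k)
  -- the decomposition `nbrU k = λ • nbr k + (V q_k + s_k λ ξ)`
  have hdecomp : ∀ k, nbrU U ξ k = lam • nbr k + ((latPt V hexFrame (hlab k) + if hshift k then V (hcpShift + ξ) else 0) +
      if hshift k then lam • ξ else 0) := fun k => by
    have e1 : latPt U hexFrame (hlab k) = lam • latPt 1 hexFrame (hlab k) + latPt V hexFrame (hlab k) := by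
      rw [latPt_eq_apply_one U, hV, latPt_eq_apply_one V]
    unfold nbrU nbr
    rw [show latPt 1 hexFrame (hlab k) = ∑ i : Fin 3, ((hlab k i : ℤ) : ℝ) • hexFrame i by simp [latPt]] at e1
    cases hshift k
    · simp only [Bool.false_eq_true, ↓reduceIte, add_zero]; rw [e1]
    · simp only [↓reduceIte, smul_add]; rw [e1, hV (hcpShift + ξ), smul_add]; abel
  -- `ρ` and `‖ξ‖` bounds
  have hrho : ∀ k, ‖latPt V hexFrame (hlab k) + if hshift k then V (hcpShift + ξ) else 0‖ ^ 2 * SC ≤ (devMaxH c w (scaleL cU) : ℝ) :=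
    fun k => by
    have h1 := (FI.mem_def.1 (hdev k)).2
    have h2 : (devSqH c w (scaleL cU) k).hi ≤ devMaxH c w (scaleL cU) := le_lmax_of_mem _ _ (List.mem_map.2 ⟨k, mem_K12H k, rfl⟩)
    have h2' : ((devSqH c w (scaleL cU) k).hi : ℝ) ≤ devMaxH c w (scaleL cU) := by exact_mod_cast h2
    exact h1.trans h2'
  have hxi : FI.mem (‖ξ‖ ^ 2) (xiSq c w) := by
    rw [EuclideanSpace.norm_sq_eq, Fin.sum_univ_three]
    simp only [Real.norm_eq_abs, sq_abs]
    exact FI.mem_add (FI.mem_add (FI.mem_sqr (hX 0)) (FI.mem_sqr (hX 1))) (FI.mem_sqr (hX 2))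
  have hξ2 : ‖ξ‖ ≤ 1 / 2 := by
    have h1 := (FI.mem_def.1 hxi).2
    have h2 : (4 : ℝ) * (xiSq c w).hi ≤ SC := by exact_mod_cast hxi4
    have h3 : ‖ξ‖ ^ 2 * SC * 4 ≤ SC * 1 := by linarith
    have hsq : ‖ξ‖ ^ 2 ≤ (1 / 2) ^ 2 := by
      have := le_of_mul_le_mul_right (by linarith : ‖ξ‖ ^ 2 * 4 * SC ≤ 1 * SC) hS
      linarith
    exact (abs_le_of_sq_le_sq' hsq (by norm_num)).2
  -- the minimum and its enclosures
  obtain ⟨k₀, -, hk₀⟩ := Finset.exists_min_image Finset.univ (fun k : Fin 12 => ‖nbrU U ξ k‖) Finset.univ_nonempty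
  have hd_le : ∀ k, ‖nbrU U ξ k₀‖ ≤ ‖nbrU U ξ k‖ := fun k => hk₀ k (Finset.mem_univ k)
  have hd0 : 0 ≤ ‖nbrU U ξ k₀‖ := norm_nonneg _
  have hDsq_lo : ∀ k, ((dSqH c w).lo : ℝ) ≤ ‖nbrU U ξ k‖ ^ 2 * SC := fun k => by
    have h1 : lmin (K12H.map fun k => (nbrSq c w k).lo) ≤ (nbrSq c w k).lo := lmin_le_of_mem _ _ (List.mem_map.2 ⟨k, mem_K12H k, rfl⟩)
    have h1' : ((lmin (K12H.map fun k => (nbrSq c w k).lo) : ℤ) : ℝ) ≤ (nbrSq c w k).lo := by exact_mod_cast h1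
    exact h1'.trans (FI.mem_def.1 (hnbr k)).1
  have hmemDsq : FI.mem (‖nbrU U ξ k₀‖ ^ 2) (dSqH c w) := by
    refine ⟨hDsq_lo k₀, ?_⟩
    have hl : (K12H.map fun k => (nbrSq c w k).hi) ≠ [] := by simp [K12H]
    obtain ⟨k', _, he⟩ := List.mem_map.1 (lmin_mem _ hl)
    have h2 := (FI.mem_def.1 (hnbr k')).2
    have hle := mul_le_mul_of_nonneg_right (pow_le_pow_left₀ hd0 (hd_le k') 2) hS.le
    show ‖nbrU U ξ k₀‖ ^ 2 * SC ≤ (((dSqH c w).hi : ℤ) : ℝ)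
    rw [show (dSqH c w).hi = lmin (K12H.map fun k => (nbrSq c w k).hi) from rfl, ← he]
    linarith
  have hmemD : FI.mem ‖nbrU U ξ k₀‖ (dEnclH c w) := by
    have := FI.mem_sqrt hmemDsq
    rwa [Real.sqrt_sq hd0] at this
  obtain ⟨hDlo, hDhi⟩ := FI.mem_def.1 hmemD
  have h0' : (0 : ℝ) < (dEnclH c w).lo := by exact_mod_cast h0
  refine fun M z j hz hrange => Or.inl ⟨j, self_mem_ball (by norm_num) z j,
    goodAtScale_of_fitBounds_hcp U ξ hU hξ2 (dlo := ((dEnclH c w).lo : ℝ) / SC) (dhi := ((dEnclH c w).hi : ℝ) / SC)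
      (d2lo := ((dSqH c w).lo : ℝ) / SC) (div_pos h0' hS) ?_ ?_ ?_ ?_ ?_ ?_ ?_ ?_ M z j hz (locHom_hcp_centre hrange)⟩
  · -- dhi ≤ 3/2
    rw [div_le_iff₀ hS]
    have : (2 : ℝ) * (dEnclH c w).hi ≤ 3 * SC := by exact_mod_cast h32
    linarith
  · -- (d) lower
    intro k
    have := mul_le_mul_of_nonneg_right (hd_le k) hS.le
    rw [div_le_iff₀ hS]
    linarith
  · -- (d) upper
    exact ⟨k₀, by rw [le_div_iff₀ hS]; exact hDhi⟩
  · -- d2lo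
    intro k
    rw [div_le_iff₀ hS]
    exact hDsq_lo k
  · -- (F1) fit: misfit ≤ ‖Vq_k‖ + ‖Vq_k'‖ + 2λ‖ξ‖
    intro k k'
    set Q : Fin 12 → E3 := fun j => latPt V hexFrame (hlab j) + if hshift j then V (hcpShift + ξ) else 0 with hQ
    set P : Fin 12 → E3 := fun j => if hshift j then lam • ξ else 0 with hP
    have hPn : ∀ j, ‖P j‖ ≤ lam * ‖ξ‖ := fun j => by
      simp only [hP]
      cases hshift j
      · simp only [Bool.false_eq_true, ↓reduceIte, norm_zero]; exact mul_nonneg hlam0 (norm_nonneg _)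
      · simp only [↓reduceIte, norm_smul, Real.norm_eq_abs, abs_of_nonneg hlam0]; exact le_rfl
    have hdk : ∀ j, nbrU U ξ j = lam • nbr j + (Q j + P j) := fun j => hdecomp j
    -- `|d − λ| ≤ ‖Q k'‖ + λ‖ξ‖`
    have hdev' : |‖nbrU U ξ k'‖ - lam| ≤ ‖Q k'‖ + lam * ‖ξ‖ := by
      have h1 := abs_norm_sub_norm_le (nbrU U ξ k') (lam • nbr k')
      rw [norm_smul, Real.norm_eq_abs, abs_of_nonneg hlam0, norm_nbr, mul_one] at h1
      have h2 : nbrU U ξ k' - lam • nbr k' = Q k' + P k' := by rw [hdk]; abel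
      rw [h2] at h1
      exact h1.trans ((norm_add_le _ _).trans (by linarith [hPn k']))
    have htri : ‖nbrU U ξ k - ‖nbrU U ξ k'‖ • nbr k‖ ≤ ‖Q k‖ + ‖Q k'‖ + 2 * (lam * ‖ξ‖) := by
      have hsplit : nbrU U ξ k - ‖nbrU U ξ k'‖ • nbr k = (Q k + P k) + (lam - ‖nbrU U ξ k'‖) • nbr k := by
        rw [hdk, sub_smul]; abel
      rw [hsplit]
      calc ‖(Q k + P k) + (lam - ‖nbrU U ξ k'‖) • nbr k‖ ≤ ‖Q k + P k‖ + ‖(lam - ‖nbrU U ξ k'‖) • nbr k‖ := norm_add_le _ _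
        _ ≤ (‖Q k‖ + ‖P k‖) + |lam - ‖nbrU U ξ k'‖| := by
            rw [norm_smul, Real.norm_eq_abs, norm_nbr, mul_one]; linarith [norm_add_le (Q k) (P k)]
        _ ≤ _ := by rw [abs_sub_comm]; linarith [hPn k]
    -- square: (a + b + c)² ≤ 3(a² + b² + c²)
    have hsq : ‖nbrU U ξ k - ‖nbrU U ξ k'‖ • nbr k‖ ^ 2 ≤ 3 * (‖Q k‖ ^ 2 + ‖Q k'‖ ^ 2 + (2 * (lam * ‖ξ‖)) ^ 2) := by
      have h1 := pow_le_pow_left₀ (norm_nonneg _) htri 2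
      have h3 : (‖Q k‖ + ‖Q k'‖ + 2 * (lam * ‖ξ‖)) ^ 2 ≤ 3 * (‖Q k‖ ^ 2 + ‖Q k'‖ ^ 2 + (2 * (lam * ‖ξ‖)) ^ 2) := by
        have s1 := sq_nonneg (‖Q k‖ - ‖Q k'‖)
        have s2 := sq_nonneg (‖Q k‖ - 2 * (lam * ‖ξ‖))
        have s3 := sq_nonneg (‖Q k'‖ - 2 * (lam * ‖ξ‖))
        have e1 : (‖Q k‖ + ‖Q k'‖ + 2 * (lam * ‖ξ‖)) ^ 2 = ‖Q k‖ ^ 2 + ‖Q k'‖ ^ 2 + (2 * (lam * ‖ξ‖)) ^ 2 +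
            2 * (‖Q k‖ * ‖Q k'‖) + 2 * (‖Q k‖ * (2 * (lam * ‖ξ‖))) + 2 * (‖Q k'‖ * (2 * (lam * ‖ξ‖))) := by ring
        have e2 : (‖Q k‖ - ‖Q k'‖) ^ 2 = ‖Q k‖ ^ 2 - 2 * (‖Q k‖ * ‖Q k'‖) + ‖Q k'‖ ^ 2 := by ring
        have e3 : (‖Q k‖ - 2 * (lam * ‖ξ‖)) ^ 2 = ‖Q k‖ ^ 2 - 2 * (‖Q k‖ * (2 * (lam * ‖ξ‖))) + (2 * (lam * ‖ξ‖)) ^ 2 := by ring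
        have e4 : (‖Q k'‖ - 2 * (lam * ‖ξ‖)) ^ 2 = ‖Q k'‖ ^ 2 - 2 * (‖Q k'‖ * (2 * (lam * ‖ξ‖))) + (2 * (lam * ‖ξ‖)) ^ 2 := by ring
        rw [e2] at s1; rw [e3] at s2; rw [e4] at s3; rw [e1]; linarith
      exact h1.trans h3
    have r1 := hrho k
    have r2 := hrho k'
    -- the kernel bound
    have hlamm : FI.mem lam (FI.ofScaled (scaleL cU)) := FI.mem_ofScaled _
    have hRm : FI.mem ((devMaxH c w (scaleL cU) : ℝ) / SC) (FI.ofScaled (devMaxH c w (scaleL cU))) := FI.mem_ofScaled _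
    have hB : FI.mem ((devMaxH c w (scaleL cU) : ℝ) / SC * ((6 : ℤ) : ℝ) + lam * lam * ‖ξ‖ ^ 2 * ((12 : ℤ) : ℝ)) (misfitH c w (scaleL cU)) :=
      FI.mem_add (FI.mem_mulInt hRm 6) (FI.mem_mulInt (FI.mem_mul (FI.mem_mul hlamm hlamm) hxi) 12)
    have hBhi := (FI.mem_def.1 hB).2
    push_cast at hBhi
    have hfitR : (1000000 : ℝ) * (misfitH c w (scaleL cU)).hi ≤ 2401 * (dSqH c w).lo := by exact_mod_cast hfitZ
    rw [show (49 / 1000 : ℝ) ^ 2 * (((dSqH c w).lo : ℝ) / SC) = 2401 * ((dSqH c w).lo : ℝ) / (1000000 * SC) by ring,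
      le_div_iff₀ (by positivity)]
    have e6 : ((devMaxH c w (scaleL cU) : ℝ) / SC * 6 + lam * lam * ‖ξ‖ ^ 2 * 12) * SC =
        6 * (devMaxH c w (scaleL cU) : ℝ) + 12 * (lam * lam * ‖ξ‖ ^ 2) * SC := by
      rw [show ((devMaxH c w (scaleL cU) : ℝ) / SC * 6 + lam * lam * ‖ξ‖ ^ 2 * 12) * SC =
        (devMaxH c w (scaleL cU) : ℝ) / SC * SC * 6 + 12 * (lam * lam * ‖ξ‖ ^ 2) * SC by ring, div_mul_cancel₀ _ hne]
      ring
    have hBhi' := mul_le_mul_of_nonneg_right hBhi hS.le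
    rw [e6] at hBhi'
    have hQk : ‖Q k‖ ^ 2 * SC ≤ (devMaxH c w (scaleL cU) : ℝ) := r1
    have hQk' : ‖Q k'‖ ^ 2 * SC ≤ (devMaxH c w (scaleL cU) : ℝ) := r2
    have hsq' := mul_le_mul_of_nonneg_right hsq (by positivity : (0 : ℝ) ≤ 1000000 * SC)
    have elam : (2 * (lam * ‖ξ‖)) ^ 2 = 4 * (lam * lam * ‖ξ‖ ^ 2) := by ring
    rw [elam] at hsq'
    linarith [hsq', hQk, hQk', hBhi', hfitR]
  · -- (F2) clean gap
    intro k
    have f3 := hK k (mem_K12H k)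
    have hC := (FI.mem_def.1 (hnbr k)).2
    have f3' : ((nbrSq c w k).hi : ℝ) * SC * 10000 ≤ (130 * (dEnclH c w).lo - SC) ^ 2 := by exact_mod_cast f3
    have h130' : (SC : ℝ) ≤ 130 * (dEnclH c w).lo := by exact_mod_cast h130
    have hC' := mul_le_mul_of_nonneg_right hC (by positivity : (0 : ℝ) ≤ SC * 10000)
    have hsq : (‖nbrU U ξ k‖ * (100 * SC)) ^ 2 ≤ ((130 : ℝ) * (dEnclH c w).lo - SC) ^ 2 := by
      have e : (‖nbrU U ξ k‖ * (100 * SC)) ^ 2 = ‖nbrU U ξ k‖ ^ 2 * SC * (SC * 10000) := by ring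
      rw [e]; linarith
    have hle := (abs_le_of_sq_le_sq' hsq (by linarith)).2
    rw [show (13 : ℝ) / 10 * (((dEnclH c w).lo : ℝ) / SC) - 1 / 100 = (130 * ((dEnclH c w).lo : ℝ) - SC) / (100 * SC) by field_simp; ring,
      le_div_iff₀ (by positivity)]
    exact hle
  · -- (F3) far, family A
    intro b hb hb0 hnot
    rw [← box7all_eq] at hb
    obtain ⟨hA, _⟩ := hfar b hb
    rcases hA with rfl | ⟨k, hk, he⟩ | f4
    · exact (hb0 rfl).elim
    · exact (hnot k hk he).elim
    · have f4' : ((130 : ℝ) * (dEnclH c w).hi + SC) ^ 2 ≤ ((qform13 (extU c w) b false).lo : ℝ) * SC * 10000 := by exact_mod_cast f4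
      have hm := mem_qform13 U (hcpShift + ξ) hUG hUC hUT b false
      simp only [Bool.false_eq_true, ↓reduceIte, add_zero] at hm
      have hC := (FI.mem_def.1 hm).1
      have hC' := mul_le_mul_of_nonneg_right hC (by positivity : (0 : ℝ) ≤ SC * 10000)
      have hsq : ((130 : ℝ) * (dEnclH c w).hi + SC) ^ 2 ≤ (‖latPt U hexFrame b‖ * (100 * SC)) ^ 2 := by
        have e : (‖latPt U hexFrame b‖ * (100 * SC)) ^ 2 = ‖latPt U hexFrame b‖ ^ 2 * SC * (SC * 10000) := by ring
        rw [e]; linarith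
      have hle := (abs_le_of_sq_le_sq' hsq (by positivity)).2
      rw [show (13 : ℝ) / 10 * (((dEnclH c w).hi : ℝ) / SC) + 1 / 100 = (130 * ((dEnclH c w).hi : ℝ) + SC) / (100 * SC) by field_simp; ring,
        div_le_iff₀ (by positivity)]
      exact hle
  · -- (F3) far, family B
    intro b hb hnot
    rw [← box7all_eq] at hb
    obtain ⟨_, hB⟩ := hfar b hb
    rcases hB with ⟨k, hk, he⟩ | f4
    · exact (hnot k hk he).elim
    · have f4' : ((130 : ℝ) * (dEnclH c w).hi + SC) ^ 2 ≤ ((qform13 (extU c w) b true).lo : ℝ) * SC * 10000 := by exact_mod_cast f4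
      have hm := mem_qform13 U (hcpShift + ξ) hUG hUC hUT b true
      simp only [↓reduceIte] at hm
      have hC := (FI.mem_def.1 hm).1
      have hC' := mul_le_mul_of_nonneg_right hC (by positivity : (0 : ℝ) ≤ SC * 10000)
      have hsq : ((130 : ℝ) * (dEnclH c w).hi + SC) ^ 2 ≤ (‖latPt U hexFrame b + U (hcpShift + ξ)‖ * (100 * SC)) ^ 2 := by
        have e : (‖latPt U hexFrame b + U (hcpShift + ξ)‖ * (100 * SC)) ^ 2 = ‖latPt U hexFrame b + U (hcpShift + ξ)‖ ^ 2 * SC * (SC * 10000) := by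
          ring
        rw [e]; linarith
      have hle := (abs_le_of_sq_le_sq' hsq (by positivity)).2
      rw [show (13 : ℝ) / 10 * (((dEnclH c w).hi : ℝ) / SC) + 1 / 100 = (130 * ((dEnclH c w).hi : ℝ) + SC) / (100 * SC) by field_simp; ring,
        div_le_iff₀ (by positivity)]
      exact hle

/-! ## §2. The full hcp verdict, its soundness, and `(H)` from two Booleans with (P1) on both families -/

/-- ★ **hcp ENTRY-LEAF VERDICT, (P1) ∨ (P4)**: fit prune ∨ (symmetry ∨ column ∨ hcp Gram-leaf checker). -/
def entryLeafOKH2 (μ : ℤ) (c w : (Fin 3 × Fin 3) ⊕ Fin 3 → ℤ) : Bool := fitOKH c w || entryLeafOKHc μ c w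

/-- ★ Soundness of `entryLeafOKH2` (shape of `…HomEntryGramHcp.hcpHalf_of_entryTree`). [folklore] -/
theorem entryLeafOKH2_sound {μ : ℤ} {c w : (Fin 3 × Fin 3) ⊕ Fin 3 → ℤ} (h : entryLeafOKH2 μ c w = true) (U : E3 →L[ℝ] E3) (ξ : E3)
    (hsa : ∀ v v' : E3, ⟪U v, v'⟫ = ⟪v, U v'⟫) (hU : ‖U - 1‖ ≤ 1 / 4)
    (hbox : ∀ ab : Fin 3 × Fin 3, |(U (EuclideanSpace.single ab.2 (1 : ℝ))) ab.1 - (c (Sum.inl ab) : ℝ) / SC| ≤ (w (Sum.inl ab) : ℝ) / SC)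
    (hξb : ∀ i : Fin 3, |ξ i - (c (Sum.inr i) : ℝ) / SC| ≤ (w (Sum.inr i) : ℝ) / SC) :
    (∀ (M : ℕ) (z : Fin M → E3) (c : Fin M), Function.Injective z →
        Set.range z = {x : E3 | dist x (z c) ≤ 133 / 10 ∧ ∃ a : Fin 3 → ℤ,
          x = z c + latPt U hexFrame a ∨ x = z c + latPt U hexFrame a + U (hcpShift + ξ)} →
        TightNearCap (9 / 5) (3 / 2) z c ∨ ExemptNear (9 / 5) ExRec z c ∨ BadNearCap (9 / 5) (3 / 2) z c) ∨
      (μ : ℝ) / SC ≤ ∑ b ∈ (Fintype.piFinset fun _ : Fin 3 => Finset.Icc (-7 : ℤ) 7).filter (fun b => b ≠ 0), effPot w₄₅ ω₄ (3 / 400) ‖latPt U hexFrame b‖ +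
        ∑ b ∈ (Fintype.piFinset fun _ : Fin 3 => Finset.Icc (-7 : ℤ) 7), effPot w₄₅ ω₄ (3 / 400) ‖latPt U hexFrame b + U (hcpShift + ξ)‖ := by
  simp only [entryLeafOKH2, Bool.or_eq_true] at h
  rcases h with h | h
  · exact Or.inl (fitOKH_sound h U ξ hU hbox hξb)
  · exact entryLeafOKHc_sound h U ξ hsa hU hbox hξb

/-- ★★ **THE hcp HALF FROM ONE BOOLEAN, (P1) ∨ (P4) leaves.** [folklore] -/
theorem hcpHalf_of_entryFitTree {m : ℝ} {μ : ℤ} (hμ : 2 * (m + (-(7175 / 10000) + 3 / 400)) * SC ≤ μ)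
    {t : CertTree ((Fin 3 × Fin 3) ⊕ Fin 3)} (h : treeOK (entryLeafOKH2 μ) t rootCH rootWH = true) :
    ∀ (U : E3 →L[ℝ] E3) (ξ : E3), (∀ v w : E3, inner ℝ (U v) w = inner ℝ v (U w)) → (∀ w : E3, 0 ≤ inner ℝ w (U w)) →
      ‖U - 1‖ ≤ 1 / 4 → ‖ξ‖ ≤ 1 / 4 →
      (∀ (M : ℕ) (z : Fin M → E3) (c : Fin M), Function.Injective z →
          Set.range z = {x : E3 | dist x (z c) ≤ 133 / 10 ∧ ∃ a : Fin 3 → ℤ,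
            x = z c + latPt U hexFrame a ∨ x = z c + latPt U hexFrame a + U (hcpShift + ξ)} →
          TightNearCap (9 / 5) (3 / 2) z c ∨ ExemptNear (9 / 5) ExRec z c ∨ BadNearCap (9 / 5) (3 / 2) z c) ∨
      m ≤ (∑ b ∈ (Fintype.piFinset fun _ : Fin 3 => Finset.Icc (-7 : ℤ) 7).filter (fun b => b ≠ 0),
          effPot w₄₅ ω₄ (3 / 400) ‖latPt U hexFrame b‖ +
        ∑ b ∈ (Fintype.piFinset fun _ : Fin 3 => Finset.Icc (-7 : ℤ) 7),
          effPot w₄₅ ω₄ (3 / 400) ‖latPt U hexFrame b + U (hcpShift + ξ)‖) / 2 - (-(7175 / 10000) + 3 / 400) :=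
  hcpHalf_of_entryTree hμ (entryLeafOKH2 μ) (fun _ _ hv U ξ hsa hU hbox hξb => entryLeafOKH2_sound hv U ξ hsa hU hbox hξb) h

/-- ★★★ **`HomFloor m` FROM TWO TREE VERDICTS with (P1) ∨ (P4) leaves on BOTH families.** [folklore] -/
theorem homFloor_of_entryFitTrees {m : ℝ} {μ : ℤ} (hμ : 2 * (m + (-(7175 / 10000) + 3 / 400)) * SC ≤ μ)
    {tF : CertTree (Fin 3 × Fin 3)} (hF : treeOK (entryLeafOKF μ) tF rootC rootW = true)
    {tH : CertTree ((Fin 3 × Fin 3) ⊕ Fin 3)} (hH : treeOK (entryLeafOKH2 μ) tH rootCH rootWH = true) : HomFloor m :=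
  homFloor_of_prunedBoxSums_selfAdjoint (fccHalf_of_entryFitTree hμ hF) (hcpHalf_of_entryFitTree hμ hH)

/-! ## §3. Kernel smoke test -/

/-- `fitOKH` fires on the entry/shuffle box of half-width `2⁻⁹` at the unstrained hcp crystal (`U = 1`, `ξ = 0`) and fails on the thin sheared box `ξ = (0.15, 0, 0)`. -/
example : fitOKH rootCH (fun _ => 549755813888) = true ∧
    fitOKH (Function.update rootCH (Sum.inr 0) 42221246506598) (fun _ => 0) = false := by
  decide +kernel

end Summit.AtomisticToContinuum.Crystallization.Theorems.FrustratedLawDichotomyStrainedPatchHomEntryFitHcp
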